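import Summits.BirchSwinnertonDyer.BirchSwinnertonDyer.Theorems.AdditiveKolyvaginRoadKolyvaginSignedJumpStrong
import Summits.BirchSwinnertonDyer.BirchSwinnertonDyer.Theorems.AdditiveKolyvaginRoadKolyvaginAxisLemma
import Summits.BirchSwinnertonDyer.BirchSwinnertonDyer.Theorems.AdditiveKolyvaginRoadLevelSystemsCanonicalLines
import Summits.BirchSwinnertonDyer.BirchSwinnertonDyer.Theorems.AdditiveKolyvaginRoadLocalDictionaries
import HarnessLib

/-!
# Route `AdditiveKolyvaginRoad`, crux `LevelKolyvaginSystemsAdditive` (item stmt-BirchSwinnertonDyer-21396, KS′):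
# the RAISE half of the twin dichotomy at a Kolyvagin prime for the MIXED level spaces, from the Poitou–Tate fact
# (cell `pub/bsd-wall`, width seat `bsd-wall-akr-p2x-w3` g7; `--supports stmt-BirchSwinnertonDyer-21396`, helper; DISCHARGES the binder `hRaise` of
# the lead's `nonempty_levelKolyvaginSystemP_of_selmerDichotomy` ∕ conjunct (Raise) of DICH in `levelKolyvaginSystemsAdditive_of_kolyvaginPrimitiveAdditive`,
# = (Jump)+(Z)+(Line) of `nonempty_levelKolyvaginSystemP_of_seed_of_twinDichotomy`, = the rising half of (Twin) in `…CanonicalUpperLevels`)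

WHAT. `selmerDichotomy_raise_of_poitouTate`: at a frame (`K` imaginary quadratic with `d_K < −4`, `p` odd, `ρ̄_{E,p}` onto, `c ≠ 1`) and granted
`poitouTate_selmerStructure_duality K`, for ANY family `𝒮 n m μ ⊂ H¹(K, E[p])` with the membership dictionary `h𝒮` (sign `μ`; Kummer at `∞` and off
`m ∪ n`; TORIC on `n`; TRANSVERSE on `m`) and finite-dimensional: at every non-empty level `n`, for a new Kolyvagin prime `ℓ ∉ m` with place `v`, if
EVERY class of `𝒮 n m μ` is locally trivial at `v` then `dim 𝒮 n (mℓ) μ = dim 𝒮 n m μ + 1`.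
PROOF. The strong signed jump (`strongSupply_of_poitouTateP`, T := m, sign μ) gives `g` of sign `μ`, off `ker loc_v`, with `loc_v g ∪ₑ loc_v g = 0` and
the conditions of `G(n, ℓ, m)`; `g` is not Kummer at `v` (else `g ∈ 𝒮 n m μ ≤ ker loc_v`); by the AXIS LEMMA (`mem_transverseLocalKerP_of_cupProduct_self_eq_zero_P`)
`g` is transverse at `v`, so `g ∈ 𝒮 n (mℓ) μ`; `𝒮 n (mℓ) μ ⊓ ker loc_v = 𝒮 n m μ` (a transverse class vanishing at `v` is Kummer there, and conversely by
hypothesis); line-rigidity in `𝒮 n (mℓ) μ` above `v` ((IsoBound) `sub_zsmul_mem_torsionLocalKer_of_isotropic_P` with the transverse isotropy); hence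
codimension one (`CanonicalLines.finrank_eq_finrank_inf_add_one`). Kolyvagin and admissible primes never share a place (`p ∣ ℓ + 1`, `p ∤ q² − 1`).

HONEST FRAMING: theorems only; 0 definitions, 0 named facts, 0 `sorry`; CONDITIONAL on the named PT fact; closes nothing. BSD is not proved by any of this.

References: [cite: MazurRubin2004, Lemma 4.1.7] [cite: Howard2004HeegnerKolyvagin, §1.6] [cite: WZhang2014, §8.1, Lemma 8.2, Lemma 8.4]
[cite: GrossLMS1991, Prop. 8.1] [cite: BertoliniDarmon2005, p. 18].
-/

-- single-conjunct summit: `Summit.BirchSwinnertonDyer.BirchSwinnertonDyer.…` repeats the name by design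
set_option linter.dupNamespace false

noncomputable section

open scoped Classical

namespace Summit.BirchSwinnertonDyer.BirchSwinnertonDyer.Theorems.AdditiveKoly

open Function WeierstrassCurve NumberField IsDedekindDomain Field
  Literature.NumberTheory.EllipticCurves Literature.NumberTheory.EllipticCurves.ModularForms
  Literature.NumberTheory.GaloisRepresentations Module
open Literature.NumberTheory.GaloisCohomology
open Summit.BirchSwinnertonDyer.Rank1Residual.X11b.Three.Koly.Method2
open Summit.BirchSwinnertonDyer.Rank1Residual.X11b

variable (W : WeierstrassCurve ℚ) (K : Type) [Field K] [NumberField K] (p : ℕ) [W.IsElliptic] [W.IsGloballyMinimal]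
  [Fact p.Prime] (ι : K →+* ℂ) (c : K ≃ₐ[ℚ] K) [Module (ZMod p) (Vp W K p)]
  [∀ v : Place K, Module (ZMod p)
    (galoisCohomology (((W.baseChange K).torsionGaloisModule ((p ^ 1 : ℕ) : ℤ)).toLocal v) 1)]
  [∀ v : Place K, CompactSpace (absoluteGaloisGroup (Place.Completion v))]
  [Finite (geomTorsion (W.baseChange K) ((p ^ 1 : ℕ) : ℤ))]

omit [W.IsElliptic] [Module (ZMod p) (Vp W K p)]
  [∀ v : Place K, Module (ZMod p) (galoisCohomology (((W.baseChange K).torsionGaloisModule ((p ^ 1 : ℕ) : ℤ)).toLocal v) 1)]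
  [∀ v : Place K, CompactSpace (absoluteGaloisGroup (Place.Completion v))]
  [Finite (geomTorsion (W.baseChange K) ((p ^ 1 : ℕ) : ℤ))] in
/-- **A Kolyvagin prime and a Bertolini–Darmon admissible prime never share a place of `K`**: `p ∣ ℓ + 1` while `p ∤ q² − 1`, so `ℓ ≠ q`,
and two distinct rational primes are coprime. [cite: WZhang2014, Notations (xii), (xiv)] [cite: BertoliniDarmon2005, p. 18] -/
theorem not_mem_asIdeal_of_kolyvagin_of_admQ (ℓ : {ℓ // Zhang2014.IsKolyvaginPrime (W.conductorNorm ℤ) W K p ℓ}) (q : AdmQ W K p)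
    (v : HeightOneSpectrum (𝓞 K)) (hq : ((q : ℕ) : 𝓞 K) ∈ v.asIdeal) : ((ℓ : ℕ) : 𝓞 K) ∉ v.asIdeal := by
  have hne : (q : ℕ) ≠ (ℓ : ℕ) := by
    intro heq
    have hk1 : 1 ≤ Zhang2014.kolyvaginIndex W p ℓ := ℓ.2.2.2.2.2.2
    have hdvd : p ∣ (ℓ : ℕ) + 1 := by
      have h := ((Zhang2014.le_kolyvaginIndex_iff (W := W) (p := p)).mp hk1).1
      rwa [pow_one] at h
    have hdvd' : (p : ℤ) ∣ ((q : ℕ) : ℤ) ^ 2 - 1 := by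
      rw [heq]
      have h1 : (p : ℤ) ∣ ((ℓ : ℕ) : ℤ) + 1 := by exact_mod_cast hdvd
      have h2 : ((ℓ : ℕ) : ℤ) ^ 2 - 1 = (((ℓ : ℕ) : ℤ) + 1) * (((ℓ : ℕ) : ℤ) - 1) := by ring
      rw [h2]
      exact dvd_mul_of_dvd_left h1 _
    exact q.2.2.2.2.1 hdvd'
  exact not_mem_asIdeal_of_coprime K ((Nat.coprime_primes q.2.1 ℓ.2.1).mpr hne) v hq

/-- **The RAISE half of the twin dichotomy at a Kolyvagin prime, for the mixed level spaces, from the Poitou–Tate fact** (PARITY-FREE: every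
non-empty level `n`; the `Even n.card` shape of the binder `hRaise` of `nonempty_levelKolyvaginSystemP_of_selmerDichotomy` is the corollary
`selmerDichotomy_raise_of_poitouTate_even`). For any family `𝒮 n m μ` with the membership dictionary `h𝒮`
(sign; Kummer at `∞` and off `m ∪ n`; toric on `n`; transverse on `m`), finite-dimensional: at a non-empty level `n`, for a new Kolyvagin
prime `ℓ ∉ m` with place `v ∋ ℓ`, if every class of `𝒮 n m μ` is locally trivial at `v` then `dim 𝒮 n (mℓ) μ = dim 𝒮 n m μ + 1`. (Strong signed
jump + axis lemma + (IsoBound) + codimension one; see the module docstring.) [cite: MazurRubin2004, Lemma 4.1.7]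
[cite: WZhang2014, Lemma 8.2, Lemma 8.4] [cite: GrossLMS1991, Prop. 8.1] -/
theorem selmerDichotomy_raise_of_poitouTate (hK : IsImaginaryQuadratic K) (hp2 : p ≠ 2) (hd : NumberField.discr K < -4)
    (hsurj : W.HasSurjectiveModNGaloisRep p) (hc : c ≠ 1) (hPT : poitouTate_selmerStructure_duality K)
    (𝒮 : Finset (AdmQ W K p) → Finset {ℓ // Zhang2014.IsKolyvaginPrime (W.conductorNorm ℤ) W K p ℓ} → Bool →
      Submodule (ZMod p) (Vp W K p))
    (h𝒮 : ∀ (n : Finset (AdmQ W K p)) (m : Finset {ℓ // Zhang2014.IsKolyvaginPrime (W.conductorNorm ℤ) W K p ℓ})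
      (μ : Bool) (x : Vp W K p), x ∈ 𝒮 n m μ ↔
        conjAct W c ((p ^ 1 : ℕ) : ℤ) x = sgnP μ • x ∧
        (∀ w : InfinitePlace K, x ∈ selmerLocalKer (W.baseChange K) w.Completion ((p ^ 1 : ℕ) : ℤ)) ∧
        (∀ v : HeightOneSpectrum (𝓞 K), (∀ ℓ ∈ m, ((ℓ : ℕ) : 𝓞 K) ∉ v.asIdeal) → (∀ q ∈ n, ((q : ℕ) : 𝓞 K) ∉ v.asIdeal) →
          x ∈ selmerLocalKer (W.baseChange K) (v.adicCompletion K) ((p ^ 1 : ℕ) : ℤ)) ∧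
        (∀ q ∈ n, ∀ v : HeightOneSpectrum (𝓞 K), ((q : ℕ) : 𝓞 K) ∈ v.asIdeal →
          x ∈ toricLocalKer (W.baseChange K) (v.adicCompletion K) ((p ^ 1 : ℕ) : ℤ)) ∧
        (∀ ℓ ∈ m, ∀ v : HeightOneSpectrum (𝓞 K), ((ℓ : ℕ) : 𝓞 K) ∈ v.asIdeal → x ∈ transverseLocalKerP W K p ι ℓ v))
    (hfin : ∀ n m μ, Module.Finite (ZMod p) (𝒮 n m μ)) :
    ∀ (n : Finset (AdmQ W K p)), n.Nonempty →
      ∀ (m : Finset {ℓ // Zhang2014.IsKolyvaginPrime (W.conductorNorm ℤ) W K p ℓ})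
        (ℓ : {ℓ // Zhang2014.IsKolyvaginPrime (W.conductorNorm ℤ) W K p ℓ}) (μ : Bool) (v : HeightOneSpectrum (𝓞 K)),
        ℓ ∉ m → ((ℓ : ℕ) : 𝓞 K) ∈ v.asIdeal →
        (∀ x ∈ 𝒮 n m μ, x ∈ (W.baseChange K).torsionLocalKer (v.adicCompletion K) ((p ^ 1 : ℕ) : ℤ)) →
        finrank (ZMod p) (𝒮 n (insert ℓ m) μ) = finrank (ZMod p) (𝒮 n m μ) + 1 := by
  intro n hn m ℓ μ v hℓm hv hund
  have hp : p.Prime := Fact.out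
  haveI : NeZero (p ^ 1 : ℕ) := ⟨pow_ne_zero 1 hp.ne_zero⟩
  -- one place above the inert `ℓ`
  have huniq : ∀ v' : HeightOneSpectrum (𝓞 K), ((ℓ : ℕ) : 𝓞 K) ∈ v'.asIdeal → v' = v := fun v' hv' ↦
    placesAbove_eq_of_isPrime_span K ℓ.2.2.2.2.2.1 ℓ.2.1.ne_zero hv hv'
  -- a Weil pairing on `E[p]`
  obtain ⟨e, hμ, hadd₁, hadd₂, halt, hnondeg, hgal⟩ :=
    exists_weilPairing_holds (W.baseChange K) (p ^ 1) (by rw [pow_one]; exact hp.two_le) (by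
      rw [pow_one]; exact_mod_cast hp.ne_zero)
  -- the strong signed jump with `T := m`, sign `μ`
  obtain ⟨g, hgs, hgloc, hginf, hgfin, hgtr⟩ :=
    strongSupply_of_poitouTateP W K p ι c hK hp2 hd hsurj hc hPT e hμ hadd₁ hadd₂ halt hnondeg hgal n hn ℓ m hℓm μ
  obtain ⟨hgZ, hgg⟩ := hgloc v hv
  -- `g` is toric above `n` and Kummer off `ℓ`, `m`, `n` (no Kolyvagin prime lies above an admissible place)
  have hgtor : ∀ q ∈ n, ∀ v' : HeightOneSpectrum (𝓞 K), ((q : ℕ) : 𝓞 K) ∈ v'.asIdeal →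
      g ∈ toricLocalKer (W.baseChange K) (v'.adicCompletion K) ((p ^ 1 : ℕ) : ℤ) := fun q hq v' hqv' ↦
    (hgfin v' (not_mem_asIdeal_of_kolyvagin_of_admQ W K p ℓ q v' hqv')
      (fun ℓ' _ ↦ not_mem_asIdeal_of_kolyvagin_of_admQ W K p ℓ' q v' hqv')).2 q hq hqv'
  -- `g` is NOT Kummer at `v` (else `g ∈ 𝒮 n m μ ≤ ker loc_v`)
  have hgK : g ∉ selmerLocalKer (W.baseChange K) (v.adicCompletion K) ((p ^ 1 : ℕ) : ℤ) := by
    intro hgK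
    refine hgZ (hund g ((h𝒮 n m μ g).mpr ⟨hgs, hginf, fun v' hvm hvn ↦ ?_, hgtor, hgtr⟩))
    by_cases hℓv' : ((ℓ : ℕ) : 𝓞 K) ∈ v'.asIdeal
    · rw [huniq v' hℓv']; exact hgK
    · exact (hgfin v' hℓv' hvm).1 hvn
  -- the AXIS LEMMA: `g` is transverse at `v`
  have hgT : g ∈ transverseLocalKerP W K p ι ℓ v :=
    mem_transverseLocalKerP_of_cupProduct_self_eq_zero_P W K p hK hp2 hd hsurj ι hc e hμ hadd₁ hadd₂ halt hnondeg hgal ℓ.2 v hv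
      μ hgs hgK hgg
  -- hence `g ∈ 𝒮 n (mℓ) μ`
  have hgA : g ∈ 𝒮 n (insert ℓ m) μ := by
    refine (h𝒮 n (insert ℓ m) μ g).mpr ⟨hgs, hginf, fun v' hvm hvn ↦ ?_, hgtor, fun ℓ' hℓ' v' hv' ↦ ?_⟩
    · exact (hgfin v' (hvm ℓ (Finset.mem_insert_self ℓ m)) (fun ℓ' hℓ' ↦ hvm ℓ' (Finset.mem_insert_of_mem hℓ'))).1 hvn
    · rcases Finset.mem_insert.mp hℓ' with rfl | hℓ'
      · rw [huniq v' hv']; exact hgT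
      · exact hgtr ℓ' hℓ' v' hv'
  -- the strict part of `𝒮 n (mℓ) μ` above `v` is `𝒮 n m μ`
  let Zv : Submodule (ZMod p) (Vp W K p) :=
    AddSubgroup.toZModSubmodule p ((W.baseChange K).torsionLocalKer (v.adicCompletion K) ((p ^ 1 : ℕ) : ℤ))
  have hZv : ∀ y, y ∈ Zv ↔ y ∈ (W.baseChange K).torsionLocalKer (v.adicCompletion K) ((p ^ 1 : ℕ) : ℤ) :=
    fun y ↦ AddSubgroup.mem_toZModSubmodule p
  have hinf : 𝒮 n (insert ℓ m) μ ⊓ Zv = 𝒮 n m μ := by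
    refine le_antisymm (fun y hy ↦ ?_) (fun y hy ↦ ?_)
    · obtain ⟨hyA, hyZ⟩ := Submodule.mem_inf.mp hy
      rw [hZv] at hyZ
      obtain ⟨hys, hyinf, hyoff, hytor, hytr⟩ := (h𝒮 n (insert ℓ m) μ y).mp hyA
      refine (h𝒮 n m μ y).mpr ⟨hys, hyinf, fun v' hvm hvn ↦ ?_, hytor,
        fun ℓ' hℓ' v' hv' ↦ hytr ℓ' (Finset.mem_insert_of_mem hℓ') v' hv'⟩
      by_cases hℓv' : ((ℓ : ℕ) : 𝓞 K) ∈ v'.asIdeal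
      · rw [huniq v' hℓv']
        exact (W.baseChange K).torsionLocalKer_le_selmerLocalKer _ _ hyZ
      · refine hyoff v' (fun ℓ'' hℓ'' ↦ ?_) hvn
        rcases Finset.mem_insert.mp hℓ'' with rfl | hℓ''
        · exact hℓv'
        · exact hvm ℓ'' hℓ''
    · obtain ⟨hys, hyinf, hyoff, hytor, hytr⟩ := (h𝒮 n m μ y).mp hy
      have hyZ := hund y hy
      refine Submodule.mem_inf.mpr ⟨(h𝒮 n (insert ℓ m) μ y).mpr ⟨hys, hyinf, fun v' hvm hvn ↦
        hyoff v' (fun ℓ' hℓ' ↦ hvm ℓ' (Finset.mem_insert_of_mem hℓ')) hvn, hytor, fun ℓ' hℓ' v' hv' ↦ ?_⟩, (hZv y).mpr hyZ⟩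
      rcases Finset.mem_insert.mp hℓ' with rfl | hℓ'
      · rw [huniq v' hv']
        exact torsionLocalKer_le_transverseLocalKerP W K p ι _ v hyZ
      · exact hytr ℓ' hℓ' v' hv'
  -- line-rigidity above `v` inside `𝒮 n (mℓ) μ` ((IsoBound) with the transverse isotropy)
  have hline : ∀ y ∈ 𝒮 n (insert ℓ m) μ, ∃ a : ZMod p, y - a • g ∈ Zv := by
    intro y hyA
    obtain ⟨hys, -, -, -, hytr⟩ := (h𝒮 n (insert ℓ m) μ y).mp hyA
    have hyT : y ∈ transverseLocalKerP W K p ι ℓ v := hytr ℓ (Finset.mem_insert_self ℓ m) v hv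
    have hcup := fun (a b : Vp W K p) (ha : a ∈ transverseLocalKerP W K p ι ℓ v)
      (hb : b ∈ transverseLocalKerP W K p ι ℓ v) ↦
      cupProduct_eq_zero_of_mem_transverseLocalKerP W K p hK ι hp2 e hμ hadd₁ hadd₂ hgal ℓ ℓ.2 v hv a b ha hb
    obtain ⟨a, ha⟩ := sub_zsmul_mem_torsionLocalKer_of_isotropic_P W K p hK hp2 hsurj hc e hμ hadd₁ hadd₂ halt hnondeg hgal
      ℓ.2 v hv μ hgs hys (hcup g g hgT hgT) (hcup g y hgT hyT) (hcup y g hyT hgT) (hcup y y hyT hyT) hgZ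
    exact ⟨(a : ZMod p), by rw [Int.cast_smul_eq_zsmul]; exact (hZv _).mpr ha⟩
  -- codimension one
  haveI := hfin n (insert ℓ m) μ
  have h := CanonicalLines.finrank_eq_finrank_inf_add_one (A := 𝒮 n (insert ℓ m) μ) (Zl := Zv) hgA
    (fun h ↦ hgZ ((hZv g).mp h)) hline
  rw [hinf] at h
  exact h

/-- **The binder `hRaise` of `nonempty_levelKolyvaginSystemP_of_selmerDichotomy` VERBATIM** (with its idle `Even n.card` guard), from the
parity-free `selmerDichotomy_raise_of_poitouTate`. [cite: MazurRubin2004, Lemma 4.1.7] [cite: WZhang2014, Lemma 8.2] -/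
theorem selmerDichotomy_raise_of_poitouTate_even (hK : IsImaginaryQuadratic K) (hp2 : p ≠ 2) (hd : NumberField.discr K < -4)
    (hsurj : W.HasSurjectiveModNGaloisRep p) (hc : c ≠ 1) (hPT : poitouTate_selmerStructure_duality K)
    (𝒮 : Finset (AdmQ W K p) → Finset {ℓ // Zhang2014.IsKolyvaginPrime (W.conductorNorm ℤ) W K p ℓ} → Bool →
      Submodule (ZMod p) (Vp W K p))
    (h𝒮 : ∀ (n : Finset (AdmQ W K p)) (m : Finset {ℓ // Zhang2014.IsKolyvaginPrime (W.conductorNorm ℤ) W K p ℓ})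
      (μ : Bool) (x : Vp W K p), x ∈ 𝒮 n m μ ↔
        conjAct W c ((p ^ 1 : ℕ) : ℤ) x = sgnP μ • x ∧
        (∀ w : InfinitePlace K, x ∈ selmerLocalKer (W.baseChange K) w.Completion ((p ^ 1 : ℕ) : ℤ)) ∧
        (∀ v : HeightOneSpectrum (𝓞 K), (∀ ℓ ∈ m, ((ℓ : ℕ) : 𝓞 K) ∉ v.asIdeal) → (∀ q ∈ n, ((q : ℕ) : 𝓞 K) ∉ v.asIdeal) →
          x ∈ selmerLocalKer (W.baseChange K) (v.adicCompletion K) ((p ^ 1 : ℕ) : ℤ)) ∧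
        (∀ q ∈ n, ∀ v : HeightOneSpectrum (𝓞 K), ((q : ℕ) : 𝓞 K) ∈ v.asIdeal →
          x ∈ toricLocalKer (W.baseChange K) (v.adicCompletion K) ((p ^ 1 : ℕ) : ℤ)) ∧
        (∀ ℓ ∈ m, ∀ v : HeightOneSpectrum (𝓞 K), ((ℓ : ℕ) : 𝓞 K) ∈ v.asIdeal → x ∈ transverseLocalKerP W K p ι ℓ v))
    (hfin : ∀ n m μ, Module.Finite (ZMod p) (𝒮 n m μ)) :
    ∀ (n : Finset (AdmQ W K p)), n.Nonempty → Even n.card →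
      ∀ (m : Finset {ℓ // Zhang2014.IsKolyvaginPrime (W.conductorNorm ℤ) W K p ℓ})
        (ℓ : {ℓ // Zhang2014.IsKolyvaginPrime (W.conductorNorm ℤ) W K p ℓ}) (μ : Bool) (v : HeightOneSpectrum (𝓞 K)),
        ℓ ∉ m → ((ℓ : ℕ) : 𝓞 K) ∈ v.asIdeal →
        (∀ x ∈ 𝒮 n m μ, x ∈ (W.baseChange K).torsionLocalKer (v.adicCompletion K) ((p ^ 1 : ℕ) : ℤ)) →
        finrank (ZMod p) (𝒮 n (insert ℓ m) μ) = finrank (ZMod p) (𝒮 n m μ) + 1 :=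
  fun n hn _ ↦ selmerDichotomy_raise_of_poitouTate W K p ι c hK hp2 hd hsurj hc hPT 𝒮 h𝒮 hfin n hn

/-! ## Instance-free form (the local `ZMod p`-structures, compactness and finiteness supplied in the kernel) -/

omit [∀ v : Place K, Module (ZMod p) (galoisCohomology (((W.baseChange K).torsionGaloisModule ((p ^ 1 : ℕ) : ℤ)).toLocal v) 1)]
  [∀ v : Place K, CompactSpace (absoluteGaloisGroup (Place.Completion v))]
  [Finite (geomTorsion (W.baseChange K) ((p ^ 1 : ℕ) : ℤ))] in
/-- **The RAISE half, instance-free** — `selmerDichotomy_raise_of_poitouTate` with the local `ZMod p`-structures on the `H¹(K_v, E[p])`, the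
compactness of the local absolute Galois groups and the finiteness of `E[p](K̄)` supplied here (the tree's standard recipe:
`AddCommGroup.zmodModule` ∕ `absoluteGaloisGroup_compactSpace` ∕ `finite_geomTorsion_of_neZero`), so that a by-name capstone can call it with the
frame data alone. [cite: MazurRubin2004, Lemma 4.1.7] [cite: WZhang2014, Lemma 8.2] -/
theorem selmerDichotomy_raise_of_poitouTate' (hK : IsImaginaryQuadratic K) (hp2 : p ≠ 2) (hd : NumberField.discr K < -4)
    (hsurj : W.HasSurjectiveModNGaloisRep p) (hc : c ≠ 1) (hPT : poitouTate_selmerStructure_duality K)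
    (𝒮 : Finset (AdmQ W K p) → Finset {ℓ // Zhang2014.IsKolyvaginPrime (W.conductorNorm ℤ) W K p ℓ} → Bool →
      Submodule (ZMod p) (Vp W K p))
    (h𝒮 : ∀ (n : Finset (AdmQ W K p)) (m : Finset {ℓ // Zhang2014.IsKolyvaginPrime (W.conductorNorm ℤ) W K p ℓ})
      (μ : Bool) (x : Vp W K p), x ∈ 𝒮 n m μ ↔
        conjAct W c ((p ^ 1 : ℕ) : ℤ) x = sgnP μ • x ∧
        (∀ w : InfinitePlace K, x ∈ selmerLocalKer (W.baseChange K) w.Completion ((p ^ 1 : ℕ) : ℤ)) ∧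
        (∀ v : HeightOneSpectrum (𝓞 K), (∀ ℓ ∈ m, ((ℓ : ℕ) : 𝓞 K) ∉ v.asIdeal) → (∀ q ∈ n, ((q : ℕ) : 𝓞 K) ∉ v.asIdeal) →
          x ∈ selmerLocalKer (W.baseChange K) (v.adicCompletion K) ((p ^ 1 : ℕ) : ℤ)) ∧
        (∀ q ∈ n, ∀ v : HeightOneSpectrum (𝓞 K), ((q : ℕ) : 𝓞 K) ∈ v.asIdeal →
          x ∈ toricLocalKer (W.baseChange K) (v.adicCompletion K) ((p ^ 1 : ℕ) : ℤ)) ∧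
        (∀ ℓ ∈ m, ∀ v : HeightOneSpectrum (𝓞 K), ((ℓ : ℕ) : 𝓞 K) ∈ v.asIdeal → x ∈ transverseLocalKerP W K p ι ℓ v))
    (hfin : ∀ n m μ, Module.Finite (ZMod p) (𝒮 n m μ)) :
    ∀ (n : Finset (AdmQ W K p)), n.Nonempty →
      ∀ (m : Finset {ℓ // Zhang2014.IsKolyvaginPrime (W.conductorNorm ℤ) W K p ℓ})
        (ℓ : {ℓ // Zhang2014.IsKolyvaginPrime (W.conductorNorm ℤ) W K p ℓ}) (μ : Bool) (v : HeightOneSpectrum (𝓞 K)),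
        ℓ ∉ m → ((ℓ : ℕ) : 𝓞 K) ∈ v.asIdeal →
        (∀ x ∈ 𝒮 n m μ, x ∈ (W.baseChange K).torsionLocalKer (v.adicCompletion K) ((p ^ 1 : ℕ) : ℤ)) →
        finrank (ZMod p) (𝒮 n (insert ℓ m) μ) = finrank (ZMod p) (𝒮 n m μ) + 1 := by
  have hp : p.Prime := Fact.out
  haveI : NeZero (p ^ 1 : ℕ) := ⟨pow_ne_zero 1 hp.ne_zero⟩
  letI : ∀ v : Place K, Module (ZMod p)
      (galoisCohomology (((W.baseChange K).torsionGaloisModule ((p ^ 1 : ℕ) : ℤ)).toLocal v) 1) := fun v ↦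
    AddCommGroup.zmodModule (fun x ↦ by
      have h := galoisCohomology.nsmul_eq_zero_of_forall
        (((W.baseChange K).torsionGaloisModule ((p ^ 1 : ℕ) : ℤ)).toLocal v) (n := p ^ 1)
        (fun m => AddSubgroup.torsionBy.nsmul m) x
      simpa using h)
  haveI : ∀ v : Place K, CompactSpace (absoluteGaloisGroup (Place.Completion v)) := fun v ↦
    absoluteGaloisGroup_compactSpace _
  haveI : Finite (geomTorsion (W.baseChange K) ((p ^ 1 : ℕ) : ℤ)) :=
    finite_geomTorsion_of_neZero (W.baseChange K) (p ^ 1)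
  exact selmerDichotomy_raise_of_poitouTate W K p ι c hK hp2 hd hsurj hc hPT 𝒮 h𝒮 hfin

end Summit.BirchSwinnertonDyer.BirchSwinnertonDyer.Theorems.AdditiveKoly

end
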